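/-
Copyright: statement-level skeleton of a published paper (lit-balaban cell, Phase-2 proof seat p39 gen 18). No proof claims
beyond what the kernel checks below.
-/
import Literature.MathematicalPhysics.QuantumFieldTheory.Balaban1983to89.B3Ineq326LastBracketLattice
import Literature.MathematicalPhysics.QuantumFieldTheory.Balaban1983to89.B3Eq334ZeroLatticePieces

/-!
# Bałaban, *(Higgs)₂,₃ quantum fields in a finite volume. III*, CMP 88 (1983), p. 442: *"… (3.31) and the first term on the right
# side is convergent"* ON THE PRINT'S CARRIER `ηℤ^{d+1}` — the `|x′−x|^α`-weighted two-point term of (3.31) gains `(L^jη)^α`,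
# uniformly in the localization set, and with NO kernel hypothesis for the (3.30) kernel of the pieces of `G_k(ηℤ^{d+1},0)`

[cite: Balaban1983Higgs3, (3.31) p.442 (PDF 32)].  Unit `lit-balaban-p39-g18` (Phase-2 proof seat p39, gen 18); fold row `B3.Eq3.25-3.32`
(owner r15; the owner's ASK (η) of 2026-08-23T03:38:11Z = the one lattice gap found in the re-audit for HEAD QUESTION 12).
v1.1 (p39 gen 19, DOC-ONLY — declarations byte-identical to p351978): the lead-in sentence before (3.31) now quotes print
exactly (ref-1 g79 F1 finding 2026-08-23T05:15:25Z: v1's *"These graphs have degree 0 and are analyzed similarly"* was a paraphrase).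
statement-level skeleton of published theorems with citation tags; proofs where landed; nothing here is a claim about the Yang–Mills
mass gap.

PDF held: `paper:balaban1983-higgs-2-3-quantum-fields-finite-volume` (journal page = PDF page + 410); p. 442 [PDF 32], render
`run/shared/lean/pub/pub-balaban/b2b-balaban-ref1/pages/1983-cmp88-higgs23-III/1983-cmp88-higgs23-III-p032-x2.png`.

THE PRINTED TEXT (verbatim, p. 442): *"The other primitively divergent graphs are considered in a simpler way, because they
have degree 0. We write
Σ_{x,x′}η^{2d}Σ_{μ,μ′}g(x)A_μ(x)Π_{μμ′}(x,x′)g′(x′)A′_{μ′}(x′) = Σ_{x,x′}η^{2d}Σ_{μ,μ′}g(x)A_μ(x)Π_{μμ′}(x,x′)|x′−x|^α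
(g′(x′)A′_{μ′}(x′) − g′(x)A′_{μ′}(x))/|x′−x|^α + Σ_xη^dΣ_{μ,μ′}g(x)A_μ(x)(Σ_{x′}η^dΠ_{μμ′}(x,x′))g′(x)A′_{μ′}(x), (3.31) and the first
term on the right side is convergent."*

CITATION HEADER (lean-in-tree rule).  (3.31) itself on `ηℤ^{d+1}` is p39 g17's `B3Eq326ZeroLattice.eq331Z` (pairing `pairSumZ`, weight
`(η·dist₁)^α`); the (3.30)-kernel `kerCZ` of the two nonlocal vector self-energy graphs and its bound for the pieces are p39's
`B3Eq326ZeroLattice.kerCZ` / p32 g30's `B3Ineq326LastBracketLattice.abs_kerCZ_le`, `abs_dAdjKernelZ_gpieceZ_le`, `abs_d2KernelZ_gpieceZ_le`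
(+ p26 g34's `B3Ineq314ZeroLattice.abs_gpieceZ_le`, `abs_pieceLatMixed_le`, `B3Ineq211ZeroLattice.ineq210_zeroLatticeH`); the volume sum
uniform in the localization set is p39 g18's `B3Eq334ZeroLatticePieces.sum_vol_exp_le`; the elementary gain is p20 g3's
`B3SubtractionAlphaGain.exp_mul_rpow_le`.  THIS FILE is the `ℤ^{d+1}` twin of p20 g3's TORUS `B3SubtractionAlphaGain.abs_first331_le`
(+ `B3AlphaGainSummed.abs_first331_le_norm`); all of the above consumed BY NAME, nothing of another seat modified.

WHAT IS PROVED (every `d`; theorems only).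
* `pairSumZ_weight_cancel` (the weight `|x′−x|^α` inserted and divided cancels inside the pairing), `abs_pairSumZ_diff_le` (the plain
  difference leg), **`abs_first331Z_le`**: under a TWO-SCALE (2.10)-type kernel bound `|Π_{μμ′}(x,x′)| ≤ K₀e^{−δη|x−x′|₁/s}e^{−δη|x−x′|₁/s′}`
  and the Hölder bound `|g′A′_{μ′}(x′) − g′A′_{μ′}(x)| ≤ H(η|x−x′|₁)^α` (`0 ≤ α ≤ 1`), the first term of (3.31) on the localization sets
  `Λ ∋ x`, `Λ′ ∋ x′` is at most `(d+1)·K₀·H·(1 + 2/δ)·min(s,s′)^α·Σ_{x∈Λ,x′∈Λ′}η^{2(d+1)}(Σ_μ|gA_μ(x)|)e^{−½δη|x−x′|₁/s}e^{−½δη|x−x′|₁/s′}` —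
  the degree-0 majorant times the gain `min(L^jη, L^{j′}η)^α` (*"convergent"*: degree `+α`);
* **`abs_first331Z_le_norm`**: `… ≤ (d+1)K₀H(1 + 2/δ)(2 + 4/δ)^{d+1}·min(s,s′)^α·min(s,s′)^{d+1}·Σ_{x∈Λ}η^{d+1}Σ_μ|gA_μ(x)|`, UNIFORMLY IN
  `Λ′` (`0 < η ≤ s, s′`);
* **`abs_first331Z_le_zeroLattice`**: the kernel hypothesis DISCHARGED for the (3.30) kernel `Π = kerCZ η (tr q²) G^η_{(j)}(0) G^η_{(j′)}(0)`
  of the pieces of `G_k(ηℤ^{d+1},0)` (`gpieceZ`): constants `δ′, C′` uniform in `k ≥ 1`, the window and the indices, with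
  `K₀ = C′|tr q²|((L^jη)^{1−(d+1)}(L^{j′}η)^{1−(d+1)} + (L^jη)^{2−(d+1)}(L^{j′}η)^{−(d+1)})`.

HONEST SCOPE / DECLARED DIVERGENCES (F7).  (i) Zero background, `|x − x′| = η·dist₁`, real vector legs `A μ x`, `tr q²` an arbitrary
real `τ` (conventions of p39's F3 / p32's file).  (ii) The Hölder bound of the LEG `g′A′` stays a hypothesis (rows B3.Eq2.11 / p. 420;
the product-rule split into `g′` and `A′` is not performed, as in p32's `abs_curly2Z_rem_le`).  (iii) In `…_zeroLattice` both lines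
are the zero-field scalar pieces with one window point (as p32/p40/p39's lattice files); the resummed kernel `Σ_{j,j′}` is a finite sum
of these (p39 F3 `graphs326Z_resum`) and is not re-bounded here.  (iv) `d = 2`: nothing specific (the statement is d-generic).  Theorems
only; no Literature fact minted, no `sorry`; standard axioms.  Value = one located member of row B3.Eq3.25-3.32 (the owner's Q12
condition), NOT summit progress.  HOME `run/shared/lean/pub/lit-balaban/` (row B3.Eq3.25-3.32, FILED.md, STATUS.md), 2026-08-23.
-/

open scoped BigOperators

namespace Literature.MathematicalPhysics.QuantumFieldTheory.Balaban1983to89.B3Eq331FirstTermZeroLattice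

open B3Taylor310Lattice (dist₁ dist₁_comm)
open B3Ineq313Lattice (KernelZ)
open B3Ineq314ZeroLattice (etaZ scaleZ gpieceZ etaZ_pos scaleZ_pos abs_gpieceZ_le abs_pieceLatMixed_le)
open B3Ineq211ZeroLattice (zeroLatticeKernelsH ineq210_zeroLatticeH)
open B3Eq326ZeroLattice (kerCZ pairSumZ)
open B3Ineq326LastBracketLattice (abs_kerCZ_le abs_dAdjKernelZ_gpieceZ_le abs_d2KernelZ_gpieceZ_le)
open B3SubtractionAlphaGain (exp_mul_rpow_le)
open B3Eq334ZeroLatticePieces (sum_vol_exp_le)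

noncomputable section

variable {d : ℕ}

/-! ## §1 The first term of (3.31) on `ηℤ^{d+1}` gains `min(s, s′)^α` -/

section FirstTerm

/-- kernel: the two-scale gain — `e^{−δu/s}e^{−δu/s′}u^α ≤ (1 + 2/δ)·min(s,s′)^α·e^{−½δu/s}e^{−½δu/s′}` (`u ≥ 0`, `0 ≤ α ≤ 1`), from
p20's one-scale `exp_mul_rpow_le` applied to the line with the smaller scale. [cite: Balaban1983Higgs3, (3.13) p.436] -/
private theorem exp_exp_mul_rpow_le {δ s s' u α : ℝ} (hδ : 0 < δ) (hs : 0 < s) (hs' : 0 < s') (hu : 0 ≤ u) (hα0 : 0 ≤ α)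
    (hα1 : α ≤ 1) :
    Real.exp (-(δ * s⁻¹ * u)) * Real.exp (-(δ * s'⁻¹ * u)) * u ^ α ≤
      (1 + 2 / δ) * (min s s') ^ α * (Real.exp (-(δ / 2 * s⁻¹ * u)) * Real.exp (-(δ / 2 * s'⁻¹ * u))) := by
  have half : ∀ {t : ℝ}, 0 < t → Real.exp (-(δ * t⁻¹ * u)) ≤ Real.exp (-(δ / 2 * t⁻¹ * u)) := by
    intro t ht
    rw [Real.exp_le_exp]
    have : 0 ≤ δ / 2 * t⁻¹ * u := by positivity
    nlinarith
  rcases le_total s s' with h | h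
  · rw [min_eq_left h]
    have hw := exp_mul_rpow_le hδ hs hu hα0 hα1
    calc Real.exp (-(δ * s⁻¹ * u)) * Real.exp (-(δ * s'⁻¹ * u)) * u ^ α
        = (Real.exp (-(δ * s⁻¹ * u)) * u ^ α) * Real.exp (-(δ * s'⁻¹ * u)) := by ring
      _ ≤ ((1 + 2 / δ) * s ^ α * Real.exp (-(δ / 2 * s⁻¹ * u))) * Real.exp (-(δ / 2 * s'⁻¹ * u)) :=
          mul_le_mul hw (half hs') (Real.exp_pos _).le (by positivity)
      _ = _ := by ring
  · rw [min_eq_right h]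
    have hw := exp_mul_rpow_le hδ hs' hu hα0 hα1
    calc Real.exp (-(δ * s⁻¹ * u)) * Real.exp (-(δ * s'⁻¹ * u)) * u ^ α
        = Real.exp (-(δ * s⁻¹ * u)) * (Real.exp (-(δ * s'⁻¹ * u)) * u ^ α) := by ring
      _ ≤ Real.exp (-(δ / 2 * s⁻¹ * u)) * ((1 + 2 / δ) * s' ^ α * Real.exp (-(δ / 2 * s'⁻¹ * u))) :=
          mul_le_mul (half hs) hw (by positivity) (Real.exp_pos _).le
      _ = _ := by ring

/-- kernel: a weight inserted and divided cancels inside the pairing — for a weight `w` vanishing only on the diagonal and a leg `D`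
vanishing on it, `pairSumZ[K](w·(D/w)) = pairSumZ[K](D)`. [cite: Balaban1983Higgs3, (3.31) p.442] -/
theorem pairSumZ_weight_cancel (η : ℝ) (K : Fin (d + 1) → Fin (d + 1) → KernelZ d) (g : (Fin (d + 1) → ℤ) → ℝ)
    (A : Fin (d + 1) → (Fin (d + 1) → ℤ) → ℝ) (w : (Fin (d + 1) → ℤ) → (Fin (d + 1) → ℤ) → ℝ)
    (hw : ∀ x x', w x x' = 0 → x = x') (D : Fin (d + 1) → (Fin (d + 1) → ℤ) → (Fin (d + 1) → ℤ) → ℝ)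
    (hD : ∀ (μ' : Fin (d + 1)) (x : Fin (d + 1) → ℤ), D μ' x x = 0) (Λ Λ' : Finset (Fin (d + 1) → ℤ)) :
    pairSumZ η K g A (fun μ' x x' => w x x' * (D μ' x x' / w x x')) Λ Λ' = pairSumZ η K g A D Λ Λ' := by
  unfold pairSumZ
  refine Finset.sum_congr rfl fun x _ => Finset.sum_congr rfl fun x' _ => ?_
  congr 1
  refine Finset.sum_congr rfl fun μ _ => Finset.sum_congr rfl fun μ' _ => ?_
  beta_reduce
  by_cases h0 : w x x' = 0
  · obtain rfl := hw x x' h0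
    simp [hD]
  · rw [mul_div_cancel₀ _ h0]

/-- kernel: **the plain-difference form** — with the two-scale kernel bound and the Hölder leg,
`|Σ_{x∈Λ,x′∈Λ′}η^{2(d+1)}Σ_{μμ′}gA_μ(x)Π_{μμ′}(x,x′)(g′A′_{μ′}(x′) − g′A′_{μ′}(x))| ≤ (d+1)K₀H(1 + 2/δ)min(s,s′)^α·Σ η^{2(d+1)}(Σ_μ|gA_μ(x)|)
e^{−½δη|x−x′|₁/s}e^{−½δη|x−x′|₁/s′}`. [cite: Balaban1983Higgs3, (3.31) p.442] -/
theorem abs_pairSumZ_diff_le (η : ℝ) (hη : 0 < η) {α H K₀ δ s s' : ℝ} (hα0 : 0 ≤ α) (hα1 : α ≤ 1) (hH : 0 ≤ H) (hK : 0 ≤ K₀)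
    (hδ : 0 < δ) (hs : 0 < s) (hs' : 0 < s') (K : Fin (d + 1) → Fin (d + 1) → KernelZ d) (g g' : (Fin (d + 1) → ℤ) → ℝ)
    (A A' : Fin (d + 1) → (Fin (d + 1) → ℤ) → ℝ) (Λ Λ' : Finset (Fin (d + 1) → ℤ))
    (hKb : ∀ (μ μ' : Fin (d + 1)) (x x' : Fin (d + 1) → ℤ), |K μ μ' x x'| ≤
      K₀ * Real.exp (-(δ * s⁻¹ * (η * dist₁ x x'))) * Real.exp (-(δ * s'⁻¹ * (η * dist₁ x x'))))
    (hφ' : ∀ (μ' : Fin (d + 1)) (x x' : Fin (d + 1) → ℤ),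
      |g' x' * A' μ' x' - g' x * A' μ' x| ≤ H * (η * dist₁ x x') ^ α) :
    |pairSumZ η K g A (fun μ' x x' => g' x' * A' μ' x' - g' x * A' μ' x) Λ Λ'| ≤
      ((d + 1 : ℕ) : ℝ) * K₀ * H * (1 + 2 / δ) * (min s s') ^ α *
        ∑ x ∈ Λ, ∑ x' ∈ Λ', η ^ (2 * (d + 1)) * ((∑ μ : Fin (d + 1), |g x * A μ x|) *
          (Real.exp (-(δ / 2 * s⁻¹ * (η * dist₁ x x'))) * Real.exp (-(δ / 2 * s'⁻¹ * (η * dist₁ x x'))))) := by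
  set C : ℝ := ((d + 1 : ℕ) : ℝ) * K₀ * H * (1 + 2 / δ) * (min s s') ^ α with hC
  have hm : 0 < min s s' := lt_min hs hs'
  -- the bound per (x, x′, μ, μ′)
  have hterm : ∀ (x x' : Fin (d + 1) → ℤ) (μ μ' : Fin (d + 1)),
      |g x * A μ x * K μ μ' x x' * (g' x' * A' μ' x' - g' x * A' μ' x)| ≤
        |g x * A μ x| * (K₀ * H * ((1 + 2 / δ) * (min s s') ^ α *
          (Real.exp (-(δ / 2 * s⁻¹ * (η * dist₁ x x'))) * Real.exp (-(δ / 2 * s'⁻¹ * (η * dist₁ x x')))))) := by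
    intro x x' μ μ'
    set u : ℝ := η * dist₁ x x' with hu
    have hu0 : 0 ≤ u := mul_nonneg hη.le (Nat.cast_nonneg _)
    have hw := exp_exp_mul_rpow_le hδ hs hs' hu0 hα0 hα1
    have hk := hKb μ μ' x x'
    have hl := hφ' μ' x x'
    calc |g x * A μ x * K μ μ' x x' * (g' x' * A' μ' x' - g' x * A' μ' x)|
        = |g x * A μ x| * |K μ μ' x x'| * |g' x' * A' μ' x' - g' x * A' μ' x| := by rw [abs_mul, abs_mul]
      _ ≤ |g x * A μ x| * (K₀ * Real.exp (-(δ * s⁻¹ * u)) * Real.exp (-(δ * s'⁻¹ * u))) * (H * u ^ α) :=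
          mul_le_mul (mul_le_mul_of_nonneg_left hk (abs_nonneg _)) hl (abs_nonneg _) (by positivity)
      _ = |g x * A μ x| * (K₀ * H) * (Real.exp (-(δ * s⁻¹ * u)) * Real.exp (-(δ * s'⁻¹ * u)) * u ^ α) := by ring
      _ ≤ |g x * A μ x| * (K₀ * H) * ((1 + 2 / δ) * (min s s') ^ α *
            (Real.exp (-(δ / 2 * s⁻¹ * u)) * Real.exp (-(δ / 2 * s'⁻¹ * u)))) :=
          mul_le_mul_of_nonneg_left hw (by positivity)
      _ = _ := by ring
  -- summation over μ, μ′ at fixed (x, x′)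
  have hinner : ∀ x x' : Fin (d + 1) → ℤ,
      |η ^ (2 * (d + 1)) * ∑ μ : Fin (d + 1), ∑ μ' : Fin (d + 1),
          g x * A μ x * K μ μ' x x' * (g' x' * A' μ' x' - g' x * A' μ' x)| ≤
        C * (η ^ (2 * (d + 1)) * ((∑ μ : Fin (d + 1), |g x * A μ x|) *
          (Real.exp (-(δ / 2 * s⁻¹ * (η * dist₁ x x'))) * Real.exp (-(δ / 2 * s'⁻¹ * (η * dist₁ x x')))))) := by
    intro x x'
    set E : ℝ := Real.exp (-(δ / 2 * s⁻¹ * (η * dist₁ x x'))) * Real.exp (-(δ / 2 * s'⁻¹ * (η * dist₁ x x'))) with hE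
    rw [abs_mul, abs_of_nonneg (by positivity : (0 : ℝ) ≤ η ^ (2 * (d + 1)))]
    have hsum : |∑ μ : Fin (d + 1), ∑ μ' : Fin (d + 1),
          g x * A μ x * K μ μ' x x' * (g' x' * A' μ' x' - g' x * A' μ' x)| ≤
        ∑ μ : Fin (d + 1), ∑ _μ' : Fin (d + 1), |g x * A μ x| * (K₀ * H * ((1 + 2 / δ) * (min s s') ^ α * E)) := by
      refine (Finset.abs_sum_le_sum_abs _ _).trans (Finset.sum_le_sum fun μ _ => ?_)
      exact (Finset.abs_sum_le_sum_abs _ _).trans (Finset.sum_le_sum fun μ' _ => hterm x x' μ μ')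
    have hconst : ∑ μ : Fin (d + 1), ∑ _μ' : Fin (d + 1), |g x * A μ x| * (K₀ * H * ((1 + 2 / δ) * (min s s') ^ α * E))
        = ((d + 1 : ℕ) : ℝ) * (K₀ * H * ((1 + 2 / δ) * (min s s') ^ α)) * ((∑ μ : Fin (d + 1), |g x * A μ x|) * E) := by
      simp only [Finset.sum_const, Finset.card_univ, Fintype.card_fin, nsmul_eq_mul, Finset.sum_mul, Finset.mul_sum]
      exact Finset.sum_congr rfl fun μ _ => by ring
    calc η ^ (2 * (d + 1)) * |∑ μ : Fin (d + 1), ∑ μ' : Fin (d + 1),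
            g x * A μ x * K μ μ' x x' * (g' x' * A' μ' x' - g' x * A' μ' x)|
        ≤ η ^ (2 * (d + 1)) * (((d + 1 : ℕ) : ℝ) * (K₀ * H * ((1 + 2 / δ) * (min s s') ^ α)) *
            ((∑ μ : Fin (d + 1), |g x * A μ x|) * E)) := by
          rw [← hconst]
          exact mul_le_mul_of_nonneg_left hsum (by positivity)
      _ = C * (η ^ (2 * (d + 1)) * ((∑ μ : Fin (d + 1), |g x * A μ x|) * E)) := by rw [hC]; ring
  -- summation over x, x′
  unfold pairSumZ
  calc |∑ x ∈ Λ, ∑ x' ∈ Λ', η ^ (2 * (d + 1)) * ∑ μ : Fin (d + 1), ∑ μ' : Fin (d + 1),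
          g x * A μ x * K μ μ' x x' * (g' x' * A' μ' x' - g' x * A' μ' x)|
      ≤ ∑ x ∈ Λ, |∑ x' ∈ Λ', η ^ (2 * (d + 1)) * ∑ μ : Fin (d + 1), ∑ μ' : Fin (d + 1),
          g x * A μ x * K μ μ' x x' * (g' x' * A' μ' x' - g' x * A' μ' x)| := Finset.abs_sum_le_sum_abs _ _
    _ ≤ ∑ x ∈ Λ, ∑ x' ∈ Λ', |η ^ (2 * (d + 1)) * ∑ μ : Fin (d + 1), ∑ μ' : Fin (d + 1),
          g x * A μ x * K μ μ' x x' * (g' x' * A' μ' x' - g' x * A' μ' x)| :=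
        Finset.sum_le_sum fun x _ => Finset.abs_sum_le_sum_abs _ _
    _ ≤ ∑ x ∈ Λ, ∑ x' ∈ Λ', C * (η ^ (2 * (d + 1)) * ((∑ μ : Fin (d + 1), |g x * A μ x|) *
          (Real.exp (-(δ / 2 * s⁻¹ * (η * dist₁ x x'))) * Real.exp (-(δ / 2 * s'⁻¹ * (η * dist₁ x x')))))) :=
        Finset.sum_le_sum fun x _ => Finset.sum_le_sum fun x' _ => hinner x x'
    _ = C * ∑ x ∈ Λ, ∑ x' ∈ Λ', η ^ (2 * (d + 1)) * ((∑ μ : Fin (d + 1), |g x * A μ x|) *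
          (Real.exp (-(δ / 2 * s⁻¹ * (η * dist₁ x x'))) * Real.exp (-(δ / 2 * s'⁻¹ * (η * dist₁ x x'))))) := by
        rw [Finset.mul_sum]
        exact Finset.sum_congr rfl fun x _ => by rw [Finset.mul_sum]

/-- kernel: `ℓ¹`-distance zero means equality. [folklore] -/
private theorem eq_of_dist₁_eq_zero {x x' : Fin (d + 1) → ℤ} (h : dist₁ x x' = 0) : x = x' := by
  funext μ
  have hμ : (x μ - x' μ).natAbs = 0 := Finset.sum_eq_zero_iff.1 h μ (Finset.mem_univ μ)
  rw [Int.natAbs_eq_zero, sub_eq_zero] at hμ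
  exact hμ

/-- **p. 442 [PDF 32]: *"… (3.31) and the first term on the right side is convergent"* — quantitative form ON THE PRINT'S CARRIER
`ηℤ^{d+1}`, PROVED** for the first term of p39 g17's `B3Eq326ZeroLattice.eq331Z` (the leg `|x′−x|^α·(g′A′_{μ′}(x′) − g′A′_{μ′}(x))/|x′−x|^α` with
`|x′−x| = η·dist₁`): under the two-scale (2.10)-type kernel bound `|Π_{μμ′}(x,x′)| ≤ K₀e^{−δη|x−x′|₁/s}e^{−δη|x−x′|₁/s′}` (scales `s = L^jη`,
`s′ = L^{j′}η` of the two lines of the degree-0 graphs (3.30)) and the Hölder bound `|g′A′_{μ′}(x′) − g′A′_{μ′}(x)| ≤ H(η|x−x′|₁)^α`,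
`0 ≤ α ≤ 1`, it is at most `(d+1)·K₀·H·(1 + 2/δ)·min(s,s′)^α·Σ_{x∈Λ,x′∈Λ′}η^{2(d+1)}(Σ_μ|gA_μ(x)|)e^{−½δη|x−x′|₁/s}e^{−½δη|x−x′|₁/s′}` — the
degree-0 majorant times the gain `min(L^jη,L^{j′}η)^α` (degree `+α > 0`: *"convergent"*; p20 g3's torus `abs_first331_le` is the
one-scale finite-volume twin). [cite: Balaban1983Higgs3, (3.31) p.442] -/
theorem abs_first331Z_le (η α : ℝ) (hη : 0 < η) {H K₀ δ s s' : ℝ} (hα0 : 0 ≤ α) (hα1 : α ≤ 1) (hH : 0 ≤ H) (hK : 0 ≤ K₀)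
    (hδ : 0 < δ) (hs : 0 < s) (hs' : 0 < s') (K : Fin (d + 1) → Fin (d + 1) → KernelZ d) (g g' : (Fin (d + 1) → ℤ) → ℝ)
    (A A' : Fin (d + 1) → (Fin (d + 1) → ℤ) → ℝ) (Λ Λ' : Finset (Fin (d + 1) → ℤ))
    (hKb : ∀ (μ μ' : Fin (d + 1)) (x x' : Fin (d + 1) → ℤ), |K μ μ' x x'| ≤
      K₀ * Real.exp (-(δ * s⁻¹ * (η * dist₁ x x'))) * Real.exp (-(δ * s'⁻¹ * (η * dist₁ x x'))))
    (hφ' : ∀ (μ' : Fin (d + 1)) (x x' : Fin (d + 1) → ℤ),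
      |g' x' * A' μ' x' - g' x * A' μ' x| ≤ H * (η * dist₁ x x') ^ α) :
    |pairSumZ η K g A (fun μ' x x' => (η * dist₁ x x') ^ α *
        ((g' x' * A' μ' x' - g' x * A' μ' x) / (η * dist₁ x x') ^ α)) Λ Λ'| ≤
      ((d + 1 : ℕ) : ℝ) * K₀ * H * (1 + 2 / δ) * (min s s') ^ α *
        ∑ x ∈ Λ, ∑ x' ∈ Λ', η ^ (2 * (d + 1)) * ((∑ μ : Fin (d + 1), |g x * A μ x|) *
          (Real.exp (-(δ / 2 * s⁻¹ * (η * dist₁ x x'))) * Real.exp (-(δ / 2 * s'⁻¹ * (η * dist₁ x x'))))) := by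
  have hw : ∀ x x' : Fin (d + 1) → ℤ, (η * (dist₁ x x' : ℝ)) ^ α = 0 → x = x' := fun x x' h0 => by
    have hnn : 0 ≤ η * (dist₁ x x' : ℝ) := by positivity
    rw [Real.rpow_eq_zero_iff_of_nonneg hnn] at h0
    have h1 : (dist₁ x x' : ℝ) = 0 := by
      rcases mul_eq_zero.1 h0.1 with h2 | h2
      · exact absurd h2 hη.ne'
      · exact h2
    exact eq_of_dist₁_eq_zero (by exact_mod_cast h1)
  rw [pairSumZ_weight_cancel η K g A (fun x x' => (η * (dist₁ x x' : ℝ)) ^ α) hw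
    (fun μ' x x' => g' x' * A' μ' x' - g' x * A' μ' x) (fun μ' x => sub_self _) Λ Λ']
  exact abs_pairSumZ_diff_le η hη hα0 hα1 hH hK hδ hs hs' K g g' A A' Λ Λ' hKb hφ'

/-- **the first term of (3.31), NORM FORM ON `ηℤ^{d+1}`, UNIFORM IN THE LOCALIZATION SET `Λ′`**: under the hypotheses of `abs_first331Z_le`
and `0 < η ≤ s`, `η ≤ s′`, it is at most `(d+1)K₀H(1 + 2/δ)(2 + 4/δ)^{d+1}·min(s,s′)^α·min(s,s′)^{d+1}·Σ_{x∈Λ}η^{d+1}Σ_μ|gA_μ(x)|` — the sum over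
`x′` made with the exponential factor of the line with the smaller scale (p39 g18's `sum_vol_exp_le`), whatever the finite part `Λ′` of
the infinite lattice (twin of p20 g3's torus `abs_first331_le_norm`). [cite: Balaban1983Higgs3, (3.31) p.442] -/
theorem abs_first331Z_le_norm (η α : ℝ) (hη : 0 < η) {H K₀ δ s s' : ℝ} (hα0 : 0 ≤ α) (hα1 : α ≤ 1) (hH : 0 ≤ H) (hK : 0 ≤ K₀)
    (hδ : 0 < δ) (hηs : η ≤ s) (hηs' : η ≤ s') (K : Fin (d + 1) → Fin (d + 1) → KernelZ d) (g g' : (Fin (d + 1) → ℤ) → ℝ)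
    (A A' : Fin (d + 1) → (Fin (d + 1) → ℤ) → ℝ) (Λ Λ' : Finset (Fin (d + 1) → ℤ))
    (hKb : ∀ (μ μ' : Fin (d + 1)) (x x' : Fin (d + 1) → ℤ), |K μ μ' x x'| ≤
      K₀ * Real.exp (-(δ * s⁻¹ * (η * dist₁ x x'))) * Real.exp (-(δ * s'⁻¹ * (η * dist₁ x x'))))
    (hφ' : ∀ (μ' : Fin (d + 1)) (x x' : Fin (d + 1) → ℤ),
      |g' x' * A' μ' x' - g' x * A' μ' x| ≤ H * (η * dist₁ x x') ^ α) :
    |pairSumZ η K g A (fun μ' x x' => (η * dist₁ x x') ^ α *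
        ((g' x' * A' μ' x' - g' x * A' μ' x) / (η * dist₁ x x') ^ α)) Λ Λ'| ≤
      ((d + 1 : ℕ) : ℝ) * K₀ * H * (1 + 2 / δ) * (min s s') ^ α * ((2 + 4 / δ) ^ (d + 1) * (min s s') ^ (d + 1)) *
        ∑ x ∈ Λ, η ^ (d + 1) * ∑ μ : Fin (d + 1), |g x * A μ x| := by
  have hs : 0 < s := lt_of_lt_of_le hη hηs
  have hs' : 0 < s' := lt_of_lt_of_le hη hηs'
  have hm : 0 < min s s' := lt_min hs hs'
  have hηm : η ≤ min s s' := le_min hηs hηs'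
  have h1 := abs_first331Z_le η α hη hα0 hα1 hH hK hδ hs hs' K g g' A A' Λ Λ' hKb hφ'
  refine h1.trans ?_
  -- drop the exponential of the larger scale, keep the one of `min s s′`
  have hdrop : ∀ x x' : Fin (d + 1) → ℤ,
      Real.exp (-(δ / 2 * s⁻¹ * (η * dist₁ x x'))) * Real.exp (-(δ / 2 * s'⁻¹ * (η * dist₁ x x'))) ≤
        Real.exp (-(δ / 2 * (min s s')⁻¹ * (η * dist₁ x x'))) := by
    intro x x'
    have hu : 0 ≤ η * (dist₁ x x' : ℝ) := by positivity
    have hle1 : ∀ t : ℝ, 0 < t → Real.exp (-(δ / 2 * t⁻¹ * (η * dist₁ x x'))) ≤ 1 := fun t ht => by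
      rw [Real.exp_le_one_iff, neg_nonpos]; positivity
    rcases le_total s s' with h | h
    · rw [min_eq_left h]
      calc _ ≤ Real.exp (-(δ / 2 * s⁻¹ * (η * dist₁ x x'))) * 1 :=
            mul_le_mul_of_nonneg_left (hle1 s' hs') (Real.exp_pos _).le
        _ = _ := mul_one _
    · rw [min_eq_right h]
      calc _ ≤ 1 * Real.exp (-(δ / 2 * s'⁻¹ * (η * dist₁ x x'))) :=
            mul_le_mul_of_nonneg_right (hle1 s hs) (Real.exp_pos _).le
        _ = _ := one_mul _
  have h2d : η ^ (2 * (d + 1)) = η ^ (d + 1) * η ^ (d + 1) := by rw [two_mul, pow_add]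
  have hx : ∀ x : Fin (d + 1) → ℤ, ∑ x' ∈ Λ', η ^ (2 * (d + 1)) * ((∑ μ : Fin (d + 1), |g x * A μ x|) *
      (Real.exp (-(δ / 2 * s⁻¹ * (η * dist₁ x x'))) * Real.exp (-(δ / 2 * s'⁻¹ * (η * dist₁ x x'))))) ≤
      ((2 + 4 / δ) ^ (d + 1) * (min s s') ^ (d + 1)) * (η ^ (d + 1) * ∑ μ : Fin (d + 1), |g x * A μ x|) := by
    intro x
    have hf : 0 ≤ ∑ μ : Fin (d + 1), |g x * A μ x| := Finset.sum_nonneg fun _ _ => abs_nonneg _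
    have hvol := sum_vol_exp_le hη hηm hδ x Λ'
    calc ∑ x' ∈ Λ', η ^ (2 * (d + 1)) * ((∑ μ : Fin (d + 1), |g x * A μ x|) *
          (Real.exp (-(δ / 2 * s⁻¹ * (η * dist₁ x x'))) * Real.exp (-(δ / 2 * s'⁻¹ * (η * dist₁ x x')))))
        ≤ ∑ x' ∈ Λ', η ^ (2 * (d + 1)) * ((∑ μ : Fin (d + 1), |g x * A μ x|) *
          Real.exp (-(δ / 2 * (min s s')⁻¹ * (η * dist₁ x x')))) :=
          Finset.sum_le_sum fun x' _ => mul_le_mul_of_nonneg_left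
            (mul_le_mul_of_nonneg_left (hdrop x x') hf) (by positivity)
      _ = η ^ (d + 1) * (∑ μ : Fin (d + 1), |g x * A μ x|) *
          ∑ x' ∈ Λ', η ^ (d + 1) * Real.exp (-(δ / 2 * (min s s')⁻¹ * (η * dist₁ x x'))) := by
          rw [Finset.mul_sum]
          exact Finset.sum_congr rfl fun x' _ => by rw [h2d]; ring
      _ ≤ η ^ (d + 1) * (∑ μ : Fin (d + 1), |g x * A μ x|) * ((2 + 4 / δ) ^ (d + 1) * (min s s') ^ (d + 1)) :=
          mul_le_mul_of_nonneg_left hvol (by positivity)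
      _ = _ := by ring
  have hc : 0 ≤ ((d + 1 : ℕ) : ℝ) * K₀ * H * (1 + 2 / δ) * (min s s') ^ α := by positivity
  calc ((d + 1 : ℕ) : ℝ) * K₀ * H * (1 + 2 / δ) * (min s s') ^ α *
        ∑ x ∈ Λ, ∑ x' ∈ Λ', η ^ (2 * (d + 1)) * ((∑ μ : Fin (d + 1), |g x * A μ x|) *
          (Real.exp (-(δ / 2 * s⁻¹ * (η * dist₁ x x'))) * Real.exp (-(δ / 2 * s'⁻¹ * (η * dist₁ x x')))))
      ≤ ((d + 1 : ℕ) : ℝ) * K₀ * H * (1 + 2 / δ) * (min s s') ^ α *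
        ∑ x ∈ Λ, ((2 + 4 / δ) ^ (d + 1) * (min s s') ^ (d + 1)) * (η ^ (d + 1) * ∑ μ : Fin (d + 1), |g x * A μ x|) :=
        mul_le_mul_of_nonneg_left (Finset.sum_le_sum fun x _ => hx x) hc
    _ = _ := by rw [← Finset.mul_sum]; ring

end FirstTerm

/-! ## §2 The kernel hypothesis DISCHARGED for the (3.30) kernel of the pieces of `G_k(ηℤ^{d+1}, 0)` -/

section Pieces

/-- kernel: a real power of a positive scale is positive. [folklore] -/
private theorem scaleZ_rpow_pos (ℓ k j : ℕ) (r : ℝ) : 0 < scaleZ ℓ k j ^ r := Real.rpow_pos_of_pos (scaleZ_pos ℓ k j) r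

/-- **p. 442 *"the first term on the right side is convergent"* FOR THE (3.30) KERNEL OF THE PIECES OF THE PRINT'S OWN §3 PROPAGATOR
`G_k(0) = G_k(ηℤ^{d+1}, 0)` — NO kernel hypothesis.**  For `d`, `L = ℓ + 1 ≥ 2` and a window `[a₋,a₊] × [0,m²₊]` (`a₋ > 0`) there are
`δ′, C′ > 0` such that for EVERY scale `k ≥ 1`, every window point, all piece indices `j, j′` (the two lines of the degree-0 graphs (3.30):
`Π_{μμ′} = kerCZ η (tr q²) G^η_{(j)}(0) G^η_{(j′)}(0)`, p39 F3's combined kernel of the two nonlocal vector self-energy graphs), every `tr q² = τ`,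
every `0 ≤ α ≤ 1`, all legs `gA`, `g′A′` with the Hölder bound `H` on `g′A′`, and all finite localization sets: the first term of (3.31)
is at most `(d+1)·K₀·H·(1 + 2/δ′)·min(L^jη,L^{j′}η)^α·Σ η^{2(d+1)}(Σ_μ|gA_μ(x)|)e^{−½δ′η|x−x′|₁/L^jη}e^{−½δ′η|x−x′|₁/L^{j′}η}` with
`K₀ = |τ|·C′·((L^jη)^{1−(d+1)}(L^{j′}η)^{1−(d+1)} + (L^jη)^{2−(d+1)}(L^{j′}η)^{−(d+1)})` (the kernel bound: p32 g30's `abs_kerCZ_le` fed with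
`abs_dAdjKernelZ_gpieceZ_le`/`abs_d2KernelZ_gpieceZ_le` and p26 g34's `abs_gpieceZ_le`/`abs_pieceLatMixed_le`/`ineq210_zeroLatticeH`).
[cite: Balaban1983Higgs3, (3.31) p.442, (2.10) p.426] -/
theorem abs_first331Z_le_zeroLattice (d ℓ : ℕ) (hℓ : 1 ≤ ℓ) (amin aplus m2plus : ℝ) (ha : 0 < amin) :
    ∃ δ' C' : ℝ, 0 < δ' ∧ 0 < C' ∧ ∀ (k : ℕ), 1 ≤ k → ∀ (a m2 : ℝ), amin ≤ a → a ≤ aplus → 0 ≤ m2 → m2 ≤ m2plus →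
      ∀ (j j' : ℕ) (τ : ℝ) {α H : ℝ}, 0 ≤ α → α ≤ 1 → 0 ≤ H →
      ∀ (g g' : (Fin (d + 1) → ℤ) → ℝ) (A A' : Fin (d + 1) → (Fin (d + 1) → ℤ) → ℝ) (Λ Λ' : Finset (Fin (d + 1) → ℤ)),
      (∀ (μ' : Fin (d + 1)) (x x' : Fin (d + 1) → ℤ),
        |g' x' * A' μ' x' - g' x * A' μ' x| ≤ H * (etaZ ℓ k * dist₁ x x') ^ α) →
        |pairSumZ (etaZ ℓ k) (kerCZ (etaZ ℓ k) τ (gpieceZ ℓ k j a m2) (gpieceZ ℓ k j' a m2)) g A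
            (fun μ' x x' => (etaZ ℓ k * dist₁ x x') ^ α *
              ((g' x' * A' μ' x' - g' x * A' μ' x) / (etaZ ℓ k * dist₁ x x') ^ α)) Λ Λ'| ≤
          ((d + 1 : ℕ) : ℝ) *
              (|τ| * (C' * (scaleZ ℓ k j ^ (1 - ((d + 1 : ℕ) : ℝ)) * scaleZ ℓ k j' ^ (1 - ((d + 1 : ℕ) : ℝ)) +
                scaleZ ℓ k j ^ (2 - ((d + 1 : ℕ) : ℝ)) * scaleZ ℓ k j' ^ (-((d + 1 : ℕ) : ℝ))))) *
              H * (1 + 2 / δ') * (min (scaleZ ℓ k j) (scaleZ ℓ k j')) ^ α *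
            ∑ x ∈ Λ, ∑ x' ∈ Λ', etaZ ℓ k ^ (2 * (d + 1)) * ((∑ μ : Fin (d + 1), |g x * A μ x|) *
              (Real.exp (-(δ' / 2 * (scaleZ ℓ k j)⁻¹ * (etaZ ℓ k * dist₁ x x'))) *
                Real.exp (-(δ' / 2 * (scaleZ ℓ k j')⁻¹ * (etaZ ℓ k * dist₁ x x'))))) := by
  obtain ⟨δa, Ca, hδa, hCa, hA⟩ := ineq210_zeroLatticeH d ℓ hℓ amin aplus m2plus ha
  obtain ⟨δm, Cm, hδm, hCm, hM⟩ := abs_pieceLatMixed_le d ℓ hℓ amin aplus m2plus ha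
  have hd1 : (0 : ℝ) < ((d + 1 : ℕ) : ℝ) := by positivity
  set δ' : ℝ := min δa δm / ((d + 1 : ℕ) : ℝ) with hδ'def
  have hδ'0 : 0 < δ' := div_pos (lt_min hδa hδm) hd1
  have hδ'a : δ' ≤ δa / ((d + 1 : ℕ) : ℝ) := div_le_div_of_nonneg_right (min_le_left _ _) hd1.le
  have hδ'm : δ' ≤ δm / ((d + 1 : ℕ) : ℝ) := div_le_div_of_nonneg_right (min_le_right _ _) hd1.le
  set C' : ℝ := max Ca Cm ^ 2 with hC'def
  have hmax : 0 < max Ca Cm := hCa.trans_le (le_max_left _ _)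
  refine ⟨δ', C', hδ'0, by positivity, ?_⟩
  intro k hk a m2 h1 h2 h3 h4 j j' τ α H hα0 hα1 hH g g' A A' Λ Λ' hφ'
  have h210 := hA k hk a m2 h1 h2 h3 h4
  have hMk := hM k hk
  -- the four kernel hypotheses of `abs_kerCZ_le` for the pieces, at the common rate `δ′`
  have hA1 : ∀ (μ' : Fin (d + 1)) (y y' : Fin (d + 1) → ℤ),
      |B3Eq326ZeroLattice.dAdjKernelZ (etaZ ℓ k)⁻¹ μ' (gpieceZ ℓ k j a m2) y y'| ≤
        Ca * scaleZ ℓ k j ^ (1 - ((d + 1 : ℕ) : ℝ)) * Real.exp (-(δ' * (scaleZ ℓ k j)⁻¹ * (etaZ ℓ k * dist₁ y y'))) :=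
    fun μ' y y' => abs_dAdjKernelZ_gpieceZ_le hℓ h210 hδ'0.le hδ'a j μ' y y'
  have hA2 : ∀ (μ : Fin (d + 1)) (y y' : Fin (d + 1) → ℤ),
      |B3Eq326ZeroLattice.dAdjKernelZ (etaZ ℓ k)⁻¹ μ (gpieceZ ℓ k j' a m2) y y'| ≤
        Ca * scaleZ ℓ k j' ^ (1 - ((d + 1 : ℕ) : ℝ)) * Real.exp (-(δ' * (scaleZ ℓ k j')⁻¹ * (etaZ ℓ k * dist₁ y y'))) :=
    fun μ y y' => abs_dAdjKernelZ_gpieceZ_le hℓ h210 hδ'0.le hδ'a j' μ y y'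
  have hB1 : ∀ y y' : Fin (d + 1) → ℤ, |gpieceZ ℓ k j a m2 y y'| ≤ Ca * scaleZ ℓ k j ^ (2 - ((d + 1 : ℕ) : ℝ)) *
      Real.exp (-(δ' * (scaleZ ℓ k j)⁻¹ * (etaZ ℓ k * dist₁ y y'))) := fun y y' =>
    abs_gpieceZ_le hℓ h210 hδ'0.le hδ'a j y y'
  have hB2 : ∀ (μ' μ : Fin (d + 1)) (y y' : Fin (d + 1) → ℤ),
      |B3Eq326ZeroLattice.d2KernelZ (etaZ ℓ k)⁻¹ μ' μ (gpieceZ ℓ k j' a m2) y y'| ≤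
        Cm * scaleZ ℓ k j' ^ (-((d + 1 : ℕ) : ℝ)) * Real.exp (-(δ' * (scaleZ ℓ k j')⁻¹ * (etaZ ℓ k * dist₁ y y'))) :=
    fun μ' μ y y' => abs_d2KernelZ_gpieceZ_le hℓ hk hCm.le (fun i hi μ ν x x' => hMk i hi a m2 h1 h2 h3 h4 μ ν x x')
      hδ'0.le hδ'm j' μ' μ y y'
  have hker := fun μ μ' x x' => abs_kerCZ_le (τ := τ) hA1 hA2 hB1 hB2 μ μ' x x'
  -- absorb the constants: `Ca·Ca, Ca·Cm ≤ (max Ca Cm)²`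
  set K₀ : ℝ := |τ| * (C' * (scaleZ ℓ k j ^ (1 - ((d + 1 : ℕ) : ℝ)) * scaleZ ℓ k j' ^ (1 - ((d + 1 : ℕ) : ℝ)) +
    scaleZ ℓ k j ^ (2 - ((d + 1 : ℕ) : ℝ)) * scaleZ ℓ k j' ^ (-((d + 1 : ℕ) : ℝ)))) with hK₀def
  have hKb : ∀ (μ μ' : Fin (d + 1)) (x x' : Fin (d + 1) → ℤ),
      |kerCZ (etaZ ℓ k) τ (gpieceZ ℓ k j a m2) (gpieceZ ℓ k j' a m2) μ μ' x x'| ≤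
        K₀ * Real.exp (-(δ' * (scaleZ ℓ k j)⁻¹ * (etaZ ℓ k * dist₁ x x'))) *
          Real.exp (-(δ' * (scaleZ ℓ k j')⁻¹ * (etaZ ℓ k * dist₁ x x'))) := by
    intro μ μ' x x'
    refine (hker μ μ' x x').trans ?_
    have hp1 := scaleZ_rpow_pos ℓ k j (1 - ((d + 1 : ℕ) : ℝ))
    have hp2 := scaleZ_rpow_pos ℓ k j' (1 - ((d + 1 : ℕ) : ℝ))
    have hp3 := scaleZ_rpow_pos ℓ k j (2 - ((d + 1 : ℕ) : ℝ))
    have hp4 := scaleZ_rpow_pos ℓ k j' (-((d + 1 : ℕ) : ℝ))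
    have hCa' : Ca ≤ max Ca Cm := le_max_left _ _
    have hCm' : Cm ≤ max Ca Cm := le_max_right _ _
    have e1 : Ca * scaleZ ℓ k j ^ (1 - ((d + 1 : ℕ) : ℝ)) * (Ca * scaleZ ℓ k j' ^ (1 - ((d + 1 : ℕ) : ℝ))) ≤
        C' * (scaleZ ℓ k j ^ (1 - ((d + 1 : ℕ) : ℝ)) * scaleZ ℓ k j' ^ (1 - ((d + 1 : ℕ) : ℝ))) := by
      rw [hC'def]
      calc Ca * scaleZ ℓ k j ^ (1 - ((d + 1 : ℕ) : ℝ)) * (Ca * scaleZ ℓ k j' ^ (1 - ((d + 1 : ℕ) : ℝ)))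
          = Ca * Ca * (scaleZ ℓ k j ^ (1 - ((d + 1 : ℕ) : ℝ)) * scaleZ ℓ k j' ^ (1 - ((d + 1 : ℕ) : ℝ))) := by ring
        _ ≤ max Ca Cm * max Ca Cm * (scaleZ ℓ k j ^ (1 - ((d + 1 : ℕ) : ℝ)) * scaleZ ℓ k j' ^ (1 - ((d + 1 : ℕ) : ℝ))) := by
            gcongr
        _ = _ := by ring
    have e2 : Ca * scaleZ ℓ k j ^ (2 - ((d + 1 : ℕ) : ℝ)) * (Cm * scaleZ ℓ k j' ^ (-((d + 1 : ℕ) : ℝ))) ≤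
        C' * (scaleZ ℓ k j ^ (2 - ((d + 1 : ℕ) : ℝ)) * scaleZ ℓ k j' ^ (-((d + 1 : ℕ) : ℝ))) := by
      rw [hC'def]
      calc Ca * scaleZ ℓ k j ^ (2 - ((d + 1 : ℕ) : ℝ)) * (Cm * scaleZ ℓ k j' ^ (-((d + 1 : ℕ) : ℝ)))
          = Ca * Cm * (scaleZ ℓ k j ^ (2 - ((d + 1 : ℕ) : ℝ)) * scaleZ ℓ k j' ^ (-((d + 1 : ℕ) : ℝ))) := by ring
        _ ≤ max Ca Cm * max Ca Cm * (scaleZ ℓ k j ^ (2 - ((d + 1 : ℕ) : ℝ)) * scaleZ ℓ k j' ^ (-((d + 1 : ℕ) : ℝ))) := by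
            gcongr
        _ = _ := by ring
    have hsum := add_le_add e1 e2
    have hE : 0 ≤ Real.exp (-(δ' * (scaleZ ℓ k j)⁻¹ * (etaZ ℓ k * dist₁ x x'))) *
        Real.exp (-(δ' * (scaleZ ℓ k j')⁻¹ * (etaZ ℓ k * dist₁ x x'))) := by positivity
    calc |τ| * (Ca * scaleZ ℓ k j ^ (1 - ((d + 1 : ℕ) : ℝ)) * (Ca * scaleZ ℓ k j' ^ (1 - ((d + 1 : ℕ) : ℝ))) +
            Ca * scaleZ ℓ k j ^ (2 - ((d + 1 : ℕ) : ℝ)) * (Cm * scaleZ ℓ k j' ^ (-((d + 1 : ℕ) : ℝ)))) *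
          (Real.exp (-(δ' * (scaleZ ℓ k j)⁻¹ * (etaZ ℓ k * dist₁ x x'))) *
            Real.exp (-(δ' * (scaleZ ℓ k j')⁻¹ * (etaZ ℓ k * dist₁ x x'))))
        ≤ |τ| * (C' * (scaleZ ℓ k j ^ (1 - ((d + 1 : ℕ) : ℝ)) * scaleZ ℓ k j' ^ (1 - ((d + 1 : ℕ) : ℝ))) +
            C' * (scaleZ ℓ k j ^ (2 - ((d + 1 : ℕ) : ℝ)) * scaleZ ℓ k j' ^ (-((d + 1 : ℕ) : ℝ)))) *
          (Real.exp (-(δ' * (scaleZ ℓ k j)⁻¹ * (etaZ ℓ k * dist₁ x x'))) *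
            Real.exp (-(δ' * (scaleZ ℓ k j')⁻¹ * (etaZ ℓ k * dist₁ x x')))) :=
          mul_le_mul_of_nonneg_right (mul_le_mul_of_nonneg_left hsum (abs_nonneg _)) hE
      _ = _ := by rw [hK₀def]; ring
  have hK0 : 0 ≤ K₀ := by
    rw [hK₀def]
    have := scaleZ_rpow_pos ℓ k j (1 - ((d + 1 : ℕ) : ℝ))
    have := scaleZ_rpow_pos ℓ k j' (1 - ((d + 1 : ℕ) : ℝ))
    have := scaleZ_rpow_pos ℓ k j (2 - ((d + 1 : ℕ) : ℝ))
    have := scaleZ_rpow_pos ℓ k j' (-((d + 1 : ℕ) : ℝ))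
    positivity
  exact abs_first331Z_le (etaZ ℓ k) α (etaZ_pos ℓ k) hα0 hα1 hH hK0 hδ'0 (scaleZ_pos ℓ k j) (scaleZ_pos ℓ k j') _ g g' A A'
    Λ Λ' hKb hφ'

end Pieces

end

end Literature.MathematicalPhysics.QuantumFieldTheory.Balaban1983to89.B3Eq331FirstTermZeroLattice
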